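import Literature.NumberTheory.NumberFields.DedekindDifferentBound
import HarnessLib

/-!
# Dedekind's different theorem, upper bound: the relative Galois case `N/K`

Topic `NumberTheory/NumberFields`. One theorem, no definitions, no named facts: for a finite
Galois extension `N/K` of number fields and a non-zero prime `P` of `𝓞 N` with ramification index
`e = e(P|p)` over `p = P ∩ 𝓞 K`,

  `P ^ j ∣ 𝔇_{N/K} → j + 1 ≤ e + v_P(e)`, i.e. `v_P(𝔇_{N/K}) ≤ e - 1 + v_P(e)`

(Bombieri–Gubler, *Heights in Diophantine Geometry*, App. B, Thm. B.2.11, upper bound; Serre,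
*Local Fields*, III §6; Neukirch, *Algebraic Number Theory*, III (2.6)). The proof is word for
word that of the absolute case in `DedekindDifferentBound.lean` (inertia field of `P` in
`Gal(N/K)` + the Eisenstein-type valuation computation `intValuation_term_le_sum` + Mathlib's
`aeval_derivative_mem_differentIdeal` and tower formula), with `ℤ ⊆ ℚ` replaced by `𝓞 K ⊆ K`;
it is kept in a separate file only for the 400-line budget. (Related, with a *local* base: the
tree's `LenstraDifferentBound.lean` and `HenselDifferentBound.lean`, Javanpeykar 2014,
Props. 4.1.1 and 4.1.3, bound `ord_β 𝔇_{B/A} ≤ e - 1 + e · ord_A(e f)` for a DVR `A`.)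

## References

* [BombieriGubler2006] E. Bombieri, W. Gubler, *Heights in Diophantine Geometry*, CUP 2006,
  App. B.2, Thm. B.2.11.
* [SerreLocalFields1979] J.-P. Serre, *Local Fields*, GTM 67, Ch. III §6 Prop. 13.
-/

noncomputable section

open IsDedekindDomain NumberField Polynomial WithZero
open scoped IntermediateField

namespace Literature.NumberTheory.NumberFields


/-- **Dedekind's different theorem, upper bound — Galois case over a number field `K`.** Let
`N/K` be a finite Galois extension of number fields, `P` a non-zero prime of `𝓞 N` with
ramification index `e = e(P|p)` over `p = P ∩ 𝓞 K`. If `P ^ j ∣ 𝔇_{N/K}` then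
`j + 1 ≤ e + v_P(e)`, i.e. `v_P(𝔇_{N/K}) ≤ e - 1 + v_P(e)` (Bombieri–Gubler, Thm. B.2.11, upper
bound, Galois case; same proof as the absolute version
`succ_le_ramificationIdx_add_multiplicity_of_pow_dvd_differentIdeal` with `ℤ, ℚ` replaced by
`𝓞 K, K`). [cite: BombieriGubler2006, Thm. B.2.11] -/
theorem succ_le_ramificationIdx_add_multiplicity_of_pow_dvd_differentIdeal_rel
    (K N : Type*) [Field K] [NumberField K] [Field N] [NumberField N] [Algebra K N]
    [IsGalois K N]
    (P : Ideal (𝓞 N)) [P.IsPrime] (hP : P ≠ ⊥) {j : ℕ}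
    (hj : P ^ j ∣ differentIdeal (𝓞 K) (𝓞 N)) :
    j + 1 ≤ P.ramificationIdx (𝓞 K) +
      multiplicity P (Ideal.span {((P.ramificationIdx (𝓞 K) : ℕ) : 𝓞 N)}) := by
  classical
  set e := P.ramificationIdx (𝓞 K) with he
  have he0 : e ≠ 0 := (Ideal.ramificationIdx_pos P (𝓞 K)).ne'
  -- Galois group and inertia field
  let G := N ≃ₐ[K] N
  have : IsGaloisGroup G (𝓞 K) (𝓞 N) := IsGaloisGroup.of_isFractionRing G (𝓞 K) (𝓞 N) K N
  let I : Subgroup G := P.inertia G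
  let E : IntermediateField K N := IntermediateField.fixedField I
  let C := 𝓞 E
  have hE : Module.finrank E N = Nat.card I := IntermediateField.finrank_fixedField_eq_card I
  let p : Ideal (𝓞 K) := P.under (𝓞 K)
  have hIcard : Nat.card I = p.ramificationIdxIn (𝓞 N) :=
    Ideal.card_inertia_eq_ramificationIdxIn (G := G) p P
  have hee := Ideal.ramificationIdxIn_eq_ramificationIdx p P G
  let H := N ≃ₐ[E] N
  have : IsGaloisGroup H C (𝓞 N) := IsGaloisGroup.of_isFractionRing H C (𝓞 N) E N
  let 𝔭 : Ideal C := P.under C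
  have hcardH := Ideal.card_inertia_eq_ramificationIdxIn (G := H) 𝔭 P
  have htop : P.inertia H = ⊤ := by
    rw [eq_top_iff]
    intro τ _
    refine AddSubgroup.mem_inertia.mpr fun x => ?_
    have hτ : τ.restrictScalars K ∈ I := by
      rw [← IntermediateField.fixingSubgroup_fixedField I]
      intro y
      exact τ.commutes y
    exact AddSubgroup.mem_inertia.mp hτ x
  rw [htop, Ideal.ramificationIdxIn_eq_ramificationIdx 𝔭 P H] at hcardH
  have h1 : Nat.card (⊤ : Subgroup H) = Nat.card H := Nat.card_congr Subgroup.topEquiv.toEquiv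
  rw [h1, IsGaloisGroup.card_eq_finrank H E N, hE, hIcard, hee] at hcardH
  -- hcardH : e = P.ramificationIdx C
  -- valuations
  let w : HeightOneSpectrum (𝓞 N) := ⟨P, inferInstance, hP⟩
  obtain ⟨π, hπ⟩ := w.intValuation_exists_uniformizer
  have h𝔭bot : 𝔭 ≠ ⊥ := Ideal.under_ne_bot C hP
  let v : HeightOneSpectrum C := ⟨𝔭, inferInstance, h𝔭bot⟩
  have hvw : w.asIdeal.LiesOver v.asIdeal := inferInstanceAs (P.LiesOver 𝔭)
  have he' : v.asIdeal.ramificationIdx' w.asIdeal = e :=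
    (Ideal.ramificationIdx'_eq_ramificationIdx 𝔭 P h𝔭bot).trans hcardH.symm
  have hπ0 : π ≠ 0 := by
    intro h
    rw [h, map_zero] at hπ
    exact exp_ne_zero hπ.symm
  -- the minimal polynomial of `π` over `C` has degree `e` (`π` generates `N` over `E`)
  have hπint : IsIntegral C π := Algebra.IsIntegral.isIntegral π
  set f := minpoly C π with hf
  have hfm : f.Monic := minpoly.monic hπint
  have hπN : IsIntegral E (π : N) := Algebra.IsIntegral.isIntegral _
  have hfN : minpoly E (π : N) = f.map (algebraMap C E) := by
    rw [minpoly.isIntegrallyClosed_eq_field_fractions' E (hπint.algebraMap (B := N)), hf,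
      minpoly.algebraMap_eq (FaithfulSMul.algebraMap_injective (𝓞 N) N)]
  have hfinrank : Module.finrank E E⟮(π : N)⟯ = f.natDegree := by
    rw [IntermediateField.adjoin.finrank hπN, hfN,
      natDegree_map_eq_of_injective (FaithfulSMul.algebraMap_injective C E)]
  have heN : Module.finrank E N = e := by rw [he, ← hee, ← hIcard, hE]
  have hdeg_le : f.natDegree ≤ e := by
    rw [← hfinrank, ← heN]
    exact Module.finrank_bot_le_finrank_of_isScalarTower E E⟮(π : N)⟯ N
  -- expansion of `aeval π g` for a polynomial `g` over `C`
  have hexp : ∀ (g : C[X]) (n : ℕ), g.natDegree < n →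
      aeval π g = ∑ k ∈ Finset.range n, algebraMap C (𝓞 N) (g.coeff k) * π ^ k := by
    intro g n hn
    rw [aeval_eq_sum_range' hn]
    simp_rw [Algebra.smul_def]
  have hdeg : f.natDegree = e := by
    refine le_antisymm hdeg_le (not_lt.mp fun hlt => ?_)
    have hsum : ∑ k ∈ Finset.range (f.natDegree + 1),
        algebraMap C (𝓞 N) (f.coeff k) * π ^ k = 0 := by
      rw [← hexp f (f.natDegree + 1) (Nat.lt_succ_self _), hf, minpoly.aeval]
    have key := intValuation_term_le_sum v w hπ (n := f.natDegree + 1)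
      (by rw [he']; exact hlt) (fun k => f.coeff k) (k₁ := f.natDegree) (Nat.lt_succ_self _)
      (by rw [hfm.coeff_natDegree]; exact one_ne_zero)
    rw [hsum, map_zero, le_zero_iff, hfm.coeff_natDegree, map_one, one_mul, map_pow, hπ,
      ← exp_nsmul] at key
    exact exp_ne_zero key
  have htop' : E⟮(π : N)⟯ = ⊤ :=
    IntermediateField.eq_of_le_of_finrank_eq le_top
      (by rw [hfinrank, hdeg, IntermediateField.finrank_top', heN])
  have hadj : Algebra.adjoin E {(π : N)} = ⊤ := by
    rw [← IntermediateField.adjoin_simple_toSubalgebra_of_isAlgebraic hπN.isAlgebraic, htop',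
      IntermediateField.top_toSubalgebra]
  have hmem : aeval π (derivative f) ∈ differentIdeal C (𝓞 N) :=
    aeval_derivative_mem_differentIdeal C E N π hadj
  -- the derivative, expanded
  have he1 : e - 1 + 1 = e := Nat.sub_add_cancel (Nat.one_le_iff_ne_zero.mpr he0)
  have hder : aeval π (derivative f) =
      ∑ k ∈ Finset.range e, algebraMap C (𝓞 N) (f.coeff (k + 1) * (k + 1 : ℕ)) * π ^ k := by
    rw [hexp (derivative f) e (lt_of_lt_of_le (natDegree_derivative_lt (hdeg ▸ he0)) hdeg.le)]
    refine Finset.sum_congr rfl fun k _ => ?_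
    rw [coeff_derivative]
    push_cast
    ring
  have hcoef : f.coeff (e - 1 + 1) * ((e - 1 : ℕ) + 1 : ℕ) = (e : C) := by
    rw [he1, ← hdeg, hfm.coeff_natDegree, one_mul]
  have hterm := intValuation_term_le_sum v w hπ (n := e) he'.ge
    (fun k => f.coeff (k + 1) * (k + 1 : ℕ)) (k₁ := e - 1) (by omega)
    (by rw [hcoef]; exact_mod_cast he0)
  rw [← hder, hcoef, map_natCast] at hterm
  -- `hterm : w (e * π^(e-1)) ≤ w (f'(π))`
  -- divisibility: reduce to the different over `C`
  have hjC : P ^ j ∣ differentIdeal C (𝓞 N) := by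
    have htower := differentIdeal_eq_differentIdeal_mul_differentIdeal (𝓞 K) C (𝓞 N)
    rw [htower] at hj
    refine (Ideal.prime_of_isPrime hP inferInstance).pow_dvd_of_dvd_mul_right j ?_ hj
    intro hdvd
    have h𝔭dvd : 𝔭 ∣ differentIdeal (𝓞 K) C := by
      rw [Ideal.dvd_iff_le] at hdvd ⊢
      exact Ideal.map_le_iff_le_comap.mp hdvd
    refine (not_dvd_differentIdeal_iff.mpr ?_) h𝔭dvd
    refine Ideal.ramificationIdx_eq_one_iff.mp ?_
    have ht := Ideal.ramificationIdx_tower (R := 𝓞 K) 𝔭 P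
    rw [← hcardH] at ht
    exact (mul_eq_right₀ he0).mp ht.symm
  have hjf : P ^ j ∣ Ideal.span {aeval π (derivative f)} :=
    hjC.trans (Ideal.dvd_iff_le.mpr ((Ideal.span_singleton_le_iff_mem _).mpr hmem))
  have hwj : w.intValuation (aeval π (derivative f)) ≤ exp (-(j : ℤ)) :=
    (w.intValuation_le_pow_iff_dvd _ j).mpr hjf
  -- conclusion
  have hfin := hterm.trans hwj
  have he0' : ((e : ℕ) : 𝓞 N) ≠ 0 := by exact_mod_cast he0
  rw [map_mul, map_pow, hπ, w.intValuation_eq_exp_neg_multiplicity he0', ← exp_nsmul, ← exp_add,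
    exp_le_exp] at hfin
  simp only [smul_neg, nsmul_eq_mul, mul_one] at hfin
  have hPw : multiplicity w.asIdeal (Ideal.span {((e : ℕ) : 𝓞 N)}) =
      multiplicity P (Ideal.span {((e : ℕ) : 𝓞 N)}) := rfl
  rw [hPw] at hfin
  change j + 1 ≤ e + multiplicity P (Ideal.span {((e : ℕ) : 𝓞 N)})
  clear_value e
  omega


end Literature.NumberTheory.NumberFields
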